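import Literature.Algebra.Homology.NormGroups
import Literature.Algebra.Homology.FiniteCyclicH2CarryCocycle
import HarnessLib

/-!
# For a CYCLIC group the fundamental class of a class module is pinned by its norm residue symbol
# (Serre, *Local Fields* XI §3 / VIII §4; Neukirch, *Bonn Lectures* II §1 (1.9): the reciprocity
# isomorphism is built from the fundamental class, and for `G` cyclic `[f] = [f'] ⟺ Σ_τ f(τ,σ) ≡
# Σ_τ f'(τ,σ) mod N_G A`) — on Mathlib's `groupCohomology`

Topic `Algebra/Homology`; namespace `Literature.Algebra.Homology`.  Proof file: theorems only (no
definition, no named fact, no instance, no notation, no `sorry`; D-0026).  Imports the tree's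
`NormGroups` (`IsClassModule.normResidueSymbol`, `normResidueSymbol_nakayamaSum : (Σ_τ φ(τ,g), N₀|K)_φ
= ḡ⁻¹`, `normResidueSymbol_eq_iff`) and `FiniteCyclicH2CarryCocycle` (`FiniteCyclic.H2π_eq_iff_sub_nakayamaSum_mem`:
for `G = ⟨σ⟩`, `[f] = [f'] ⟺ Σ_τ f(τ,σ) − Σ_τ f'(τ,σ) ∈ N_G A`).

**`IsClassModule.H2π_eq_of_normResidueSymbol_eq`**: for a finite CYCLIC group `G` and two
class-module structures `(A, [φ])`, `(A, [φ'])` on the same module whose norm residue symbols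
`A^G → G^{ab}` agree, `[φ] = [φ']`.  (Both symbols send `Σ_τ φ'(τ, σ)` to `σ̄⁻¹`; equal symbols of
`Σ_τ φ(τ,σ)` and `Σ_τ φ'(τ,σ)` mean these differ by a norm; for cyclic `G` that is `[φ] = [φ']`.)  For
non-cyclic `G` this fails (`[φ'] = r[φ]` with `r ≡ 1` mod the exponent of `G^{ab}` has the same symbol),
so cyclicity is essential.  Use: the classes of the tree's `exists_isClassModule_normResidueSymbol_eq`
(idèle classes of a cyclic extension of number fields, norm residue symbol = the Artin map) and
`UnitsLayer.exists_isClassModule_units_normResidueSymbol_eq` (local) are UNIQUE —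
`IsClassModule.H2π_eq_of_normResidueSymbol_eq_hom` (symbols prescribed by one homomorphism).

## References
* J.-P. Serre, *Local Fields*, GTM 67 (1979), VIII §4 (Cor. to Prop. 6 and Remark), XI §3. [Serre1979]
* J. Neukirch, *Class Field Theory — The Bonn Lectures* (2013), II §1 Thm. (1.9) and the Nakayama map.
  [Neukirch2013]
-/

noncomputable section

open CategoryTheory CategoryTheory.Limits groupCohomology

namespace Literature.Algebra.Homology

-- As in the tree's `NormGroups`: for an abstract `A : Rep ℤ G` the `ℤ`-module structure carried by
-- `A` (`A.hV2`) and Mathlib's generic `AddCommGroup.toIntModule` are not definitionally equal; the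
-- generic instance is disabled in this file so that `A.ρ.invariants` elaborates with `A`'s structure.
attribute [-instance] AddCommGroup.toIntModule

variable {G : Type} [Group G] [Fintype G] {A : Rep.{0} ℤ G} {φ φ' : cocycles₂ A}

/-- **For `G` cyclic, two fundamental classes of the same module with the same norm residue symbol are
equal**: `(·, N₀|K)_φ = (·, N₀|K)_{φ'}` on `A^G` ⟹ `[φ] = [φ']` in `H²(G, A)`.
[cite: Serre1979, VIII §4 (Corollary to Prop. 6 and Remark)][cite: Neukirch2013, Part II §1 Thm. (1.9)] -/
theorem IsClassModule.H2π_eq_of_normResidueSymbol_eq [IsCyclic G] (hA : IsClassModule A φ)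
    (hA' : IsClassModule A φ')
    (h : ∀ a : A.ρ.invariants, hA.normResidueSymbol a = hA'.normResidueSymbol a) :
    H2π A φ = H2π A φ' := by
  obtain ⟨σ, hσ⟩ := IsCyclic.exists_generator (α := G)
  rw [FiniteCyclic.H2π_eq_iff_sub_nakayamaSum_mem σ hσ A]
  have key : hA.normResidueSymbol (Nakayama.nakayamaSum φ σ) =
      hA.normResidueSymbol (Nakayama.nakayamaSum φ' σ) := by
    rw [hA.normResidueSymbol_nakayamaSum, h, hA'.normResidueSymbol_nakayamaSum]
  exact (hA.normResidueSymbol_eq_iff _ _).1 key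

/-- The same with the symbols prescribed by one homomorphism `ψ` on a set of generators of `A^G`: if
`(s i, ·)_φ = ψ i = (s i, ·)_{φ'}` for a family `s` spanning `A^G` additively, then `[φ] = [φ']`
(`G` cyclic). [cite: Neukirch2013, Part II §1 Thm. (1.9)] -/
theorem IsClassModule.H2π_eq_of_normResidueSymbol_eq_on_span [IsCyclic G] (hA : IsClassModule A φ)
    (hA' : IsClassModule A φ') {ι : Type} (s : ι → A.ρ.invariants)
    (hs : AddSubgroup.closure (Set.range s) = ⊤)
    (h : ∀ i, hA.normResidueSymbol (s i) = hA'.normResidueSymbol (s i)) :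
    H2π A φ = H2π A φ' := by
  refine hA.H2π_eq_of_normResidueSymbol_eq hA' fun a => ?_
  have ha : a ∈ AddSubgroup.closure (Set.range s) := by rw [hs]; exact AddSubgroup.mem_top a
  -- both symbols are homomorphisms `A^G →+ G^{ab}` (written additively): compare on the closure
  have hhom : ∀ b ∈ AddSubgroup.closure (Set.range s), hA.normResidueHom b = hA'.normResidueHom b := by
    intro b hb
    induction hb using AddSubgroup.closure_induction with
    | mem x hx =>
      obtain ⟨i, rfl⟩ := hx
      rw [IsClassModule.normResidueHom_apply, IsClassModule.normResidueHom_apply, h i]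
    | zero => rw [map_zero, map_zero]
    | add x y _ _ hx hy => rw [map_add, map_add, hx, hy]
    | neg x _ hx => rw [map_neg, map_neg, hx]
  have := hhom a ha
  rw [IsClassModule.normResidueHom_apply, IsClassModule.normResidueHom_apply] at this
  exact Additive.ofMul.injective this

end Literature.Algebra.Homology

end
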